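import Summits.ResolutionOfSingularities.ResolutionOfSingularities.Theorems.FrobeniusClosingPatchingRelPerfectDepthPhaseCOnePieces
import Summits.ResolutionOfSingularities.ResolutionOfSingularities.Theorems.FrobeniusClosingPatchingRelPerfectDepthPhaseCLocalGamePersistence
import Literature.AlgebraicGeometry.Resolution.MarkedIdealsEtale
import Literature.AlgebraicGeometry.Resolution.EffectiveCartierStalks
import Literature.AlgebraicGeometry.Resolution.HypersurfaceRestrictionTransform
import Literature.AlgebraicGeometry.Resolution.BlowupSequencesSingleOff
import Literature.AlgebraicGeometry.Resolution.SpreadModelDataSpread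
import HarnessLib

/-!
# [OURS · L1 W5.2 · (β-AX) X3 C-I (G-T) (iv′)] Sequential patching, I: the FACTORIZATION GLUE along an open immersion

Sub-problem `ResolutionOfSingularities`, crux `PatchingRelPerfect` (stmt-ResolutionOfSingularities-16161), line
`Cruxes/PatchingRelPerfect/Lines/closed_point_slice.lean`, engine (G2), Prop `X3LemmaM.EndOrderReduction` of
`…DepthPhaseCX3Defs`.  Object (iv′) of res-D-pv-046 21:29:08Z (3) / res-L1-w52-lead-1 R13-4 (2): the GLUE that turns ONE-PATCH
order reductions on pairwise disjoint closed pieces of `Sing(K, m)`, each inside one open patch, into the conclusion of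
`EndOrderReduction m` — Bierstone–Milman's sequential chart-by-chart argument [BM 2006, Lemma 8.7 / proof of Thm. 8.5 Step 1]
in the regime where it is sound under the Props of record ((H-pt), res-D-pv-046 ENGINE NOTE 4 CLAIM 2, last paragraph).

This file is part I: the factorization package `K·𝒪 = M · K₁` (`M` effective Cartier, `ord K₁ < m`, `K₁` locally END) is
carried from the top of a multiple blow-up `s` of an open `j : U ⟶ X` to the top of its extension `CentreSeqExtend.extend s j`.

* §1 small tools: local END agrees where two ideal sheaves agree on an open; an ideal sheaf is determined by its restrictions
  to an open immersion and an open covering the rest; cancellation `(M·K₁ : M) = K₁` for `M` effective Cartier.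
* §2 **`exists_factorization_of_isOpenImmersion`** — the base case: `M' := j_* M`, `K' := (K : M')`.
* §3 **`exists_factorization_extend`** — recursion on `s` (the shape of `exists_isEndNear_extend`).

Part II (`…DepthPhaseCLocalGamePieces`) runs the induction over the pieces.

## References
* E. Bierstone, P. Milman, *Desingularization of toric and binomial varieties*, J. Algebraic Geom. 15 (2006), arXiv:math/0411340,
  Lemma 8.7 and proof of Thm. 8.5, Step 1. [BierstoneMilman2006]
* U. Görtz, T. Wedhorn, *Algebraic Geometry I* (2nd ed. 2020), Prop. 13.91 (1)–(3). [GortzWedhorn2020]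
* The Stacks Project, Tag 01WS (effective Cartier divisors are local), Tag 0809. [StacksProject]
-/

-- `Summit.<Summit>.<Sub>.Theorems` with `Sub = Summit` (single-conjunct summit, D-0017)
set_option linter.dupNamespace false

noncomputable section

namespace Summit.ResolutionOfSingularities.ResolutionOfSingularities.Theorems.X3LemmaM

open CategoryTheory AlgebraicGeometry TopologicalSpace IsLocalRing
open Literature.AlgebraicGeometry.Resolution
open Scheme.IdealSheafData

universe u

variable {X : Scheme.{u}}

/-! ## §1 Tools -/

/-- Stalks at `j u` agree when the pull-backs along the open immersion `j` agree. [folklore] -/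
theorem stalkIdeal_eq_of_comap_eq {U : Scheme.{u}} (j : U ⟶ X) [IsOpenImmersion j] {I J : X.IdealSheafData}
    (h : I.comap j = J.comap j) (u : U) : stalkIdeal I (j.base u) = stalkIdeal J (j.base u) := by
  have key : ∀ L : X.IdealSheafData,
      stalkIdeal L (j.base u) = (stalkIdeal (L.comap j) u).comap (j.stalkMap u).hom := by
    intro L
    rw [stalkIdeal_comap_of_isOpenImmersion,
      Ideal.comap_map_of_bijective _ (ConcreteCategory.bijective_of_isIso (j.stalkMap _))]
  rw [key I, key J, h]

/-- **Local END is local**: if `K` and `K'` agree on an open `W ∋ x` then `K` is locally END at `x` iff `K'` is (same letters).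
[cite: BierstoneGrigorievMilmanWlodarczyk2011, Def. 3.1.3 (2)] -/
theorem isEndNear_congr_of_comap_eq [IsLocallyNoetherian X] {K K' : X.IdealSheafData} (W : X.Opens)
    (hW : K.comap W.ι = K'.comap W.ι) {𝓛 : List X.IdealSheafData} {x : X} (hx : x ∈ W) (h : IsEndNear K 𝓛 x) :
    IsEndNear K' 𝓛 x := by
  obtain ⟨Λ, hΛ, U, hxU, hsnc, 𝒦, hbd, hne, hK⟩ := h
  refine ⟨Λ, hΛ, U ⊓ W, ⟨hxU, hx⟩, hasSNC_map_comap_ι_of_le inf_le_left hsnc, 𝒦, hbd, hne, ?_⟩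
  rw [← comap_ι_eq_of_le inf_le_right hW]
  exact comap_ι_eq_of_le inf_le_left hK

/-- **An ideal sheaf is determined by its restrictions to an open immersion `j` and to an open `W` covering the rest.**
[folklore] -/
theorem eq_of_comap_eq_of_comap_ι_eq {U : Scheme.{u}} (j : U ⟶ X) [IsOpenImmersion j] (W : X.Opens)
    {I J : X.IdealSheafData} (hcov : ∀ x, x ∉ W → x ∈ Set.range j.base) (h₁ : I.comap j = J.comap j)
    (h₂ : I.comap W.ι = J.comap W.ι) : I = J := by
  have key : ∀ x, stalkIdeal I x = stalkIdeal J x := fun x => by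
    by_cases hx : x ∈ W
    · exact stalkIdeal_eq_of_comap_ι_eq h₂ hx
    · obtain ⟨u, rfl⟩ := hcov x hx
      exact stalkIdeal_eq_of_comap_eq j h₁ u
  exact le_antisymm (le_of_forall_stalkIdeal_le fun x => (key x).le)
    (le_of_forall_stalkIdeal_le fun x => (key x).ge)

/-- **Cancellation of an effective Cartier factor in a colon**: `(M · K₁ : M) = K₁`. [cite: StacksProject, Tag 01WS] -/
theorem colon_mul_eq_of_isEffectiveCartier {M K₁ : X.IdealSheafData} (hM : IsEffectiveCartier M) :
    colon (M * K₁) M = K₁ :=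
  le_antisymm (hM.le_of_mul_le_mul (mul_colon_le (M * K₁) M)) (le_colon_iff.mpr le_rfl)

/-! ## §2 The base case: gluing a factorization along an open immersion -/

/-- [OURS · L1 W5.2 · (iv′)] **FACTORIZATION GLUE along an open immersion.**  `j : U ⟶ X` an open immersion of Noetherian
schemes, `Z ⊆ j(U)` closed, `R ⊆ X` arbitrary («the other pieces»).  Suppose `K` is locally END (letters `𝓛₀`) at its
cosupport points off `Z` and has order `< m` off `Z ∪ R`, and on `U` a factorization `K|_U = M · K₁` is given with `M`
effective Cartier cosupported over `Z`, `ord K₁ < m` and `K₁` locally END (letters `𝓛'`) at the points over `Z`.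
THEN `K = M' · K'` on `X` with `M' := j_* M` effective Cartier cosupported in `Z`,
`K' := (K : M')` of order `< m` off `R`, locally END on its whole cosupport (letters `𝓛₀ ++ j_* 𝓛'`), and `cosupp K' ⊆ cosupp K`.
[cite: BierstoneMilman2006, Lemma 8.7] [cite: GortzWedhorn2020, Prop. 13.91 (1)] [cite: StacksProject, Tag 01WS] -/
theorem exists_factorization_of_isOpenImmersion {U : Scheme.{u}} [IsNoetherian X] [IsNoetherian U] (j : U ⟶ X)
    [IsOpenImmersion j] {Z R : Set X} (hZ : IsClosed Z) (hZj : Z ⊆ Set.range j.base) (K : X.IdealSheafData)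
    (𝓛₀ : List X.IdealSheafData) (m : ℕ) (hend : ∀ x ∈ (K.support : Set X), x ∉ Z → IsEndNear K 𝓛₀ x)
    (hord : ∀ x, x ∉ Z → x ∉ R → idealOrder K x < m) (M K₁ : U.IdealSheafData) (𝓛' : List U.IdealSheafData)
    (hfac : K.comap j = M * K₁) (hM : IsEffectiveCartier M) (hMZ : (M.support : Set U) ⊆ j.base ⁻¹' Z)
    (hK₁ord : ∀ u, j.base u ∈ Z → idealOrder K₁ u < m)
    (hK₁end : ∀ u ∈ (K₁.support : Set U), j.base u ∈ Z → IsEndNear K₁ 𝓛' u) :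
    ∃ (M' K' : X.IdealSheafData) (𝓛'' : List X.IdealSheafData), K = M' * K' ∧ IsEffectiveCartier M' ∧
      (M'.support : Set X) ⊆ Z ∧ (∀ x, x ∉ R → idealOrder K' x < m) ∧
      (∀ x ∈ (K'.support : Set X), IsEndNear K' 𝓛'' x) ∧ (K'.support : Set X) ⊆ K.support := by
  -- the glued sheaves
  set M' : X.IdealSheafData := M.map j with hM'def
  set K' : X.IdealSheafData := colon K M' with hK'def
  set W : X.Opens := ⟨Zᶜ, hZ.isOpen_compl⟩ with hWdef
  haveI : IsLocallyNoetherian (W : Scheme.{u}) := isLocallyNoetherian_of_isOpenImmersion W.ι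
  have hcov : ∀ x, x ∉ W → x ∈ Set.range j.base := fun x hx => hZj (not_not.mp hx)
  -- restrictions to `U` and to `W = X ∖ Z`
  have hM'j : M'.comap j = M := CentreSeqExtend.comap_map_of_isOpenImmersion M j
  have hM'Z : (M'.support : Set X) ⊆ Z := CentreSeqExtend.support_map_subset M j hZ hMZ
  have hM'W : M'.comap W.ι = ⊤ := comap_eq_top_of_support_subset hM'Z W.ι (by rintro _ ⟨y, rfl⟩; exact y.2)
  have hK'j : K'.comap j = K₁ := by
    rw [hK'def, comap_colon_of_flat j, hfac, hM'j]
    exact colon_mul_eq_of_isEffectiveCartier hM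
  have hK'W : K'.comap W.ι = K.comap W.ι := by
    rw [hK'def, comap_colon_of_flat W.ι, hM'W, colon_top]
  -- (1) the factorization
  have hfac' : K = M' * K' := by
    refine eq_of_comap_eq_of_comap_ι_eq j W hcov ?_ ?_
    · rw [comap_mul, hM'j, hK'j, hfac]
    · rw [comap_mul, hM'W, hK'W, Scheme.IdealSheafData.top_mul]
  refine ⟨M', K', 𝓛₀ ++ 𝓛'.map (·.map j), hfac', ?_, hM'Z, ?_, ?_, ?_⟩
  · -- (2) `M'` is effective Cartier: pointwise Cartier locus
    rw [isEffectiveCartier_iff_forall_mem_cartierLocus]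
    intro x
    by_cases hx : x ∈ Z
    · obtain ⟨u, rfl⟩ := hZj hx
      have hu : u ∈ cartierLocus (M'.comap j) := by rw [hM'j]; exact hM.mem_cartierLocus u
      exact (mem_cartierLocus_comap_iff j u M').mp hu
    · exact mem_cartierLocus_of_not_mem_support M' fun h => hx (hM'Z h)
  · -- (3) orders off `R`
    intro x hxR
    by_cases hx : x ∈ Z
    · obtain ⟨u, rfl⟩ := hZj hx
      rw [← idealOrder_comap_of_isOpenImmersion j K' u, hK'j]
      exact hK₁ord u hx
    · have h1 := idealOrder_comap_of_isOpenImmersion W.ι K' ⟨x, hx⟩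
      rw [hK'W, idealOrder_comap_of_isOpenImmersion W.ι K ⟨x, hx⟩] at h1
      change idealOrder K x = idealOrder K' x at h1
      rw [← h1]
      exact hord x hx hxR
  · -- (4) local END on the whole cosupport
    intro x hxK'
    by_cases hx : x ∈ Z
    · obtain ⟨u, rfl⟩ := hZj hx
      have hu : u ∈ (K₁.support : Set U) := by
        rw [← hK'j]
        exact (mem_support_comap_iff j K' u).mpr hxK'
      have h1 := hK₁end u hu hx
      rw [← hK'j] at h1
      exact (h1.of_comap_isOpenImmersion j).mono fun F hF => List.mem_append_right _ hF
    · have hxW : x ∈ W := hx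
      have hxK : x ∈ (K.support : Set X) := by
        change x ∈ K'.support at hxK'
        change x ∈ K.support
        rw [mem_support_iff_stalkIdeal_le] at hxK' ⊢
        rwa [stalkIdeal_eq_of_comap_ι_eq hK'W.symm hxW]
      exact (isEndNear_congr_of_comap_eq W hK'W.symm hxW (hend x hxK hx)).mono
        fun F hF => List.mem_append_left _ hF
  · -- (5) cosupports
    exact Scheme.IdealSheafData.support_antitone (le_colon_self K M')

/-! ## §3 Through the extension of a multiple blow-up from an open -/

/-- [OURS · L1 W5.2 · (iv′)] **THE FACTORIZATION PACKAGE TRANSFERS THROUGH `CentreSeqExtend.extend`.**  `s` a multiple blow-up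
of `U` (open in `X` via `j`) with centres over the closed `Z ⊆ j(U)`; `K` locally END (letters `𝓛₀`) at its cosupport points
off `Z` and of order `< m` off `Z ∪ R`; on the top of `s` a factorization `(K|_U)·𝒪 = M · K₁` with `M` effective Cartier
cosupported over `Z`, `ord K₁ < m` and `K₁` locally END at the points over `Z`.  THEN on the top of `extend s j`: `K·𝒪 = M' · K'` with `M'` effective Cartier cosupported over `Z`, `ord K' < m` off the preimage of `R`,
`K'` locally END on its whole cosupport, and `cosupp K' ⊆` the preimage of `cosupp K`.
[cite: BierstoneMilman2006, Lemma 8.7; proof of Thm. 8.5, Step 1] [cite: GortzWedhorn2020, Prop. 13.91 (1)–(3)] -/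
theorem exists_factorization_extend : ∀ {X U : Scheme.{u}} (s : CentreSeq U) (j : U ⟶ X) [IsOpenImmersion j]
    [IsNoetherian X] [IsNoetherian U] {Z R : Set X}, IsClosed Z → Z ⊆ Set.range j.base → s.CentresOver (j.base ⁻¹' Z) →
    ∀ (K : X.IdealSheafData) (𝓛₀ : List X.IdealSheafData) (m : ℕ),
    (∀ x ∈ (K.support : Set X), x ∉ Z → IsEndNear K 𝓛₀ x) →
    (∀ x, x ∉ Z → x ∉ R → idealOrder K x < m) →
    ∀ (M K₁ : s.top.IdealSheafData) (𝓛' : List s.top.IdealSheafData),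
    (K.comap j).comap s.comp = M * K₁ → IsEffectiveCartier M →
    (M.support : Set s.top) ⊆ s.comp.base ⁻¹' (j.base ⁻¹' Z) →
    (∀ y, j.base (s.comp.base y) ∈ Z → idealOrder K₁ y < m) →
    (∀ y ∈ (K₁.support : Set s.top), j.base (s.comp.base y) ∈ Z → IsEndNear K₁ 𝓛' y) →
    ∃ (M' K' : (CentreSeqExtend.extend s j).top.IdealSheafData)
      (𝓛'' : List (CentreSeqExtend.extend s j).top.IdealSheafData),
      K.comap (CentreSeqExtend.extend s j).comp = M' * K' ∧ IsEffectiveCartier M' ∧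
      (M'.support : Set (CentreSeqExtend.extend s j).top) ⊆ (CentreSeqExtend.extend s j).comp.base ⁻¹' Z ∧
      (∀ y, (CentreSeqExtend.extend s j).comp.base y ∉ R → idealOrder K' y < m) ∧
      (∀ y ∈ (K'.support : Set (CentreSeqExtend.extend s j).top), IsEndNear K' 𝓛'' y) ∧
      (K'.support : Set (CentreSeqExtend.extend s j).top) ⊆ (CentreSeqExtend.extend s j).comp.base ⁻¹' K.support
  | X, U, .nil _, j, _, _, _, Z, R, hZ, hZj, _, K, 𝓛₀, m, hend, hord, M, K₁, 𝓛', hfac, hM, hMZ, hK₁ord, hK₁end => by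
    change U.IdealSheafData at M K₁
    change List U.IdealSheafData at 𝓛'
    have hc : (K.comap j).comap (CentreSeq.nil U).comp = K.comap j := Scheme.IdealSheafData.comap_id _
    rw [hc] at hfac
    obtain ⟨M', K', 𝓛'', h1, h2, h3, h4, h5, h6⟩ := exists_factorization_of_isOpenImmersion j hZ hZj K 𝓛₀ m hend hord
      M K₁ 𝓛' hfac hM hMZ hK₁ord hK₁end
    refine ⟨M', K', 𝓛'', ?_, h2, h3, h4, h5, h6⟩
    change K.comap (𝟙 X) = M' * K'
    rwa [Scheme.IdealSheafData.comap_id]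
  | X, U, .cons C rest, j, _, _, _, Z, R, hZ, hZj, hover, K, 𝓛₀, m, hend, hord, M, K₁, 𝓛', hfac, hM, hMZ, hK₁ord,
      hK₁end => by
    obtain ⟨hC, hrest⟩ := hover
    change rest.top.IdealSheafData at M K₁
    change List rest.top.IdealSheafData at 𝓛'
    haveI hN' : IsNoetherian (blowup (C.map j)) := isNoetherian_of_isBlowup (blowup.isBlowup _)
    haveI : IsNoetherian (blowup C) := isNoetherian_of_isBlowup (blowup.isBlowup _)
    haveI := CentreSeqExtend.isOpenImmersion_liftOpen C j
    have hCZ : (((C.map j).support : Set X)) ⊆ Z := CentreSeqExtend.support_map_subset C j hZ hC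
    -- `π` is an open immersion off `π⁻¹ V(j_* C) ⊆ π⁻¹ Z`
    set V : (blowup (C.map j)).Opens := blowup.π (C.map j) ⁻¹ᵁ centreCompl (C.map j) with hVdef
    haveI hφ : IsOpenImmersion (V.ι ≫ blowup.π (C.map j)) :=
      (blowup.isBlowup (C.map j)).isOpenImmersion_preimage_compl_ι
    haveI : CompactSpace (V : Scheme.{u}) :=
      isCompact_iff_compactSpace.mp (TopologicalSpace.NoetherianSpace.isCompact (V : Set (blowup (C.map j))))
    haveI : IsNoetherian (V : Scheme.{u}) := ⟨⟩
    -- END of `K·𝒪` on `Bl_{j_* C} X` off `π⁻¹ Z`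
    have hend' : ∀ y' ∈ ((K.comap (blowup.π (C.map j))).support : Set (blowup (C.map j))),
        y' ∉ (blowup.π (C.map j)).base ⁻¹' Z →
        IsEndNear (K.comap (blowup.π (C.map j)))
          ((𝓛₀.map (·.comap (V.ι ≫ blowup.π (C.map j)))).map (·.map V.ι)) y' := by
      intro y' hy' hyZ
      have hyV : y' ∈ V := fun h => hyZ (hCZ h)
      have hx : (blowup.π (C.map j)).base y' ∈ (K.support : Set X) := (mem_support_comap_iff _ K y').mp hy'
      have h0 : IsEndNear K 𝓛₀ ((V.ι ≫ blowup.π (C.map j)).base ⟨y', hyV⟩) := hend _ hx hyZ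
      have h1 := h0.comap_of_isOpenImmersion (V.ι ≫ blowup.π (C.map j))
      rw [Scheme.IdealSheafData.comap_comp] at h1
      exact h1.of_comap_isOpenImmersion V.ι
    -- orders of `K·𝒪` off `π⁻¹ (Z ∪ R)`
    have hord' : ∀ y', y' ∉ (blowup.π (C.map j)).base ⁻¹' Z → y' ∉ (blowup.π (C.map j)).base ⁻¹' R →
        idealOrder (K.comap (blowup.π (C.map j))) y' < m := by
      intro y' hyZ hyR
      have hyV : y' ∈ V := fun h => hyZ (hCZ h)
      have h1 := idealOrder_comap_of_isOpenImmersion V.ι (K.comap (blowup.π (C.map j))) ⟨y', hyV⟩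
      rw [← Scheme.IdealSheafData.comap_comp, idealOrder_comap_of_isOpenImmersion (V.ι ≫ blowup.π (C.map j))] at h1
      change idealOrder K ((blowup.π (C.map j)).base y') = idealOrder (K.comap (blowup.π (C.map j))) y' at h1
      rw [← h1]
      exact hord _ hyZ hyR
    -- the `s`-side data, rewritten for the recursion
    have e : (K.comap j).comap (rest.comp ≫ blowup.π C) =
        ((K.comap (blowup.π (C.map j))).comap (CentreSeqExtend.liftOpen C j)).comap rest.comp := by
      simp only [← Scheme.IdealSheafData.comap_comp, Category.assoc, CentreSeqExtend.liftOpen_π]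
    have hpt : ∀ y : rest.top, (CentreSeqExtend.liftOpen C j).base (rest.comp.base y) ∈ (blowup.π (C.map j)).base ⁻¹' Z ↔
        j.base ((CentreSeq.cons C rest).comp.base y) ∈ Z := by
      intro y
      have : (blowup.π (C.map j)).base ((CentreSeqExtend.liftOpen C j).base (rest.comp.base y)) =
          j.base ((CentreSeq.cons C rest).comp.base y) := by
        change ((rest.comp ≫ CentreSeqExtend.liftOpen C j) ≫ blowup.π (C.map j)).base y = (rest.comp ≫ blowup.π C ≫ j).base y
        rw [Category.assoc, CentreSeqExtend.liftOpen_π]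
      rw [Set.mem_preimage, this]
    have hfac' : ((K.comap (blowup.π (C.map j))).comap (CentreSeqExtend.liftOpen C j)).comap rest.comp = M * K₁ := by
      rw [← e]; exact hfac
    have hMZ' : (M.support : Set rest.top) ⊆
        rest.comp.base ⁻¹' ((CentreSeqExtend.liftOpen C j).base ⁻¹' ((blowup.π (C.map j)).base ⁻¹' Z)) := by
      intro y hy
      exact (hpt y).mpr (hMZ hy)
    have hK₁ord' : ∀ y, (CentreSeqExtend.liftOpen C j).base (rest.comp.base y) ∈ (blowup.π (C.map j)).base ⁻¹' Z →
        idealOrder K₁ y < m := fun y hy => hK₁ord y ((hpt y).mp hy)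
    have hK₁end' : ∀ y ∈ (K₁.support : Set rest.top),
        (CentreSeqExtend.liftOpen C j).base (rest.comp.base y) ∈ (blowup.π (C.map j)).base ⁻¹' Z →
        IsEndNear K₁ 𝓛' y := fun y hy hyZ => hK₁end y hy ((hpt y).mp hyZ)
    obtain ⟨M', K', 𝓛'', h1, h2, h3, h4, h5, h6⟩ := exists_factorization_extend rest (CentreSeqExtend.liftOpen C j)
      (Z := (blowup.π (C.map j)).base ⁻¹' Z) (R := (blowup.π (C.map j)).base ⁻¹' R)
      (hZ.preimage (blowup.π (C.map j)).continuous) (CentreSeqExtend.range_liftOpen_of_mem C j hZj)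
      (by rw [CentreSeqExtend.preimage_liftOpen]; exact hrest) (K.comap (blowup.π (C.map j))) _ m hend' hord'
      M K₁ 𝓛' hfac' hM hMZ' hK₁ord' hK₁end'
    refine ⟨M', K', 𝓛'', ?_, h2, ?_, ?_, h5, ?_⟩
    · change K.comap ((CentreSeqExtend.extend rest (CentreSeqExtend.liftOpen C j)).comp ≫ blowup.π (C.map j)) = M' * K'
      rw [Scheme.IdealSheafData.comap_comp]
      exact h1
    · intro y hy
      exact h3 hy
    · intro y hyR
      exact h4 y hyR
    · intro y hy
      have := h6 hy
      rw [Set.mem_preimage, Scheme.IdealSheafData.support_comap] at this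
      exact this

end Summit.ResolutionOfSingularities.ResolutionOfSingularities.Theorems.X3LemmaM

end
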